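import Mathlib
import Literature.MathematicalPhysics.StatisticalMechanics.LennardJonesClusters

/-!
# Far-shell tail of inverse-sixth-power sums over separated configurations

For a configuration `y : Fin N → ℝ³` with all mutual distances `≥ δ₀ > 0`, the tail of the
site sum `∑_{j ≠ i} |yᵢ - yⱼ|⁻⁶` beyond a range `ℓ ≥ δ₀` is `≤ C(δ₀) · ℓ⁻³`, uniformly in `N`,
`y`, `i` (here `C(δ₀) = 250 δ₀⁻³`). This controls the truncation error of every Lennard-Jones
site energy at range `ℓ`.

Proof: dyadic shells `2ᵏ ℓ ≤ |yᵢ - yⱼ| < 2ᵏ⁺¹ ℓ` (`k = log₂ ⌊|yᵢ - yⱼ| / ℓ⌋`). By the packing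
bound `card_le_of_separated_of_dist_le`, shell `k` holds at most `(2 · 2ᵏ⁺¹ ℓ / δ₀ + 1)³ ≤
(5 · 2ᵏ ℓ / δ₀)³` points, each contributing `≤ (2ᵏ ℓ)⁻⁶`; so shell `k` contributes
`≤ 125 δ₀⁻³ ℓ⁻³ 2⁻³ᵏ ≤ 125 δ₀⁻³ ℓ⁻³ 2⁻ᵏ`, and `∑ₖ 2⁻ᵏ ≤ 2`.
-/

namespace Summit.AtomisticToContinuum.Crystallization.Theorems.PricedHcpWindowsFarTail

open Filter Topology
open Literature.MathematicalPhysics.StatisticalMechanics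

/-- Numerics of one dyadic shell: with `P = 2ᵏ ≥ 1` and `0 < δ₀ ≤ ℓ`,
`(2 · (2 P ℓ) / δ₀ + 1)³ · ℓ⁻⁶ · P⁻⁶ ≤ 125 · δ₀⁻³ · ℓ⁻³ · P⁻¹`. [folklore] -/
theorem shell_numerics {δ₀ ℓ P : ℝ} (hδ₀ : 0 < δ₀) (hℓ : δ₀ ≤ ℓ) (hP : 1 ≤ P) :
    (2 * (2 * P * ℓ) / δ₀ + 1) ^ 3 * (ℓ⁻¹ ^ 6 * P⁻¹ ^ 6) ≤
      125 * δ₀⁻¹ ^ 3 * ℓ⁻¹ ^ 3 * P⁻¹ := by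
  have hℓpos : 0 < ℓ := hδ₀.trans_le hℓ
  have hPpos : 0 < P := one_pos.trans_le hP
  have key : (2 * (2 * P * ℓ) / δ₀ + 1) ^ 3 * (ℓ⁻¹ ^ 6 * P⁻¹ ^ 6) =
      (4 * P * ℓ + δ₀) ^ 3 / (δ₀ ^ 3 * ℓ ^ 6 * P ^ 6) := by
    field_simp
    ring
  have key2 : 125 * δ₀⁻¹ ^ 3 * ℓ⁻¹ ^ 3 * P⁻¹ =
      125 * ℓ ^ 3 * P ^ 5 / (δ₀ ^ 3 * ℓ ^ 6 * P ^ 6) := by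
    field_simp
  rw [key, key2, div_le_div_iff_of_pos_right (by positivity)]
  have hPℓ : ℓ ≤ P * ℓ := le_mul_of_one_le_left hℓpos.le hP
  have h5 : 4 * P * ℓ + δ₀ ≤ 5 * (P * ℓ) := by linarith
  have h6 : (4 * P * ℓ + δ₀) ^ 3 ≤ (5 * (P * ℓ)) ^ 3 := pow_le_pow_left₀ (by positivity) h5 3
  have h7 : (P * ℓ) ^ 3 * 1 ≤ (P * ℓ) ^ 3 * P ^ 2 :=
    mul_le_mul_of_nonneg_left (one_le_pow₀ hP) (by positivity)
  calc (4 * P * ℓ + δ₀) ^ 3 ≤ (5 * (P * ℓ)) ^ 3 := h6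
    _ = 125 * ((P * ℓ) ^ 3 * 1) := by ring
    _ ≤ 125 * ((P * ℓ) ^ 3 * P ^ 2) := mul_le_mul_of_nonneg_left h7 (by norm_num)
    _ = 125 * ℓ ^ 3 * P ^ 5 := by ring

/-- **Far-shell tail bound.** For every `δ₀ > 0` there is `C ≥ 0` (namely `C = 250 δ₀⁻³`) such
that for every configuration `y : Fin N → ℝ³` with mutual distances `≥ δ₀`, every site `i` and
every range `ℓ ≥ δ₀`, `∑_{j ≠ i, |yᵢ - yⱼ| ≥ ℓ} |yᵢ - yⱼ|⁻⁶ ≤ C ℓ⁻³`. Dyadic shells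
`2ᵏ ℓ ≤ |yᵢ - yⱼ| < 2ᵏ⁺¹ ℓ` hold `≤ (5 · 2ᵏ ℓ / δ₀)³` points by the packing bound
`card_le_of_separated_of_dist_le`, each contributing `≤ (2ᵏ ℓ)⁻⁶`. [folklore] -/
theorem stub_farTail : ∀ δ₀ : ℝ, 0 < δ₀ → ∃ C : ℝ, 0 ≤ C ∧ ∀ (N : ℕ) (y : Fin N → EuclideanSpace ℝ (Fin 3)), (∀ i j : Fin N, i ≠ j → δ₀ ≤ dist (y i) (y j)) → ∀ (i : Fin N) (ℓ : ℝ), δ₀ ≤ ℓ → ∑ j ∈ (Finset.univ.erase i).filter (fun j => ℓ ≤ dist (y i) (y j)), (dist (y i) (y j))⁻¹ ^ 6 ≤ C * ℓ⁻¹ ^ 3 := by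
  intro δ₀ hδ₀
  refine ⟨250 * δ₀⁻¹ ^ 3, by positivity, ?_⟩
  intro N y hsep i ℓ hℓ
  have hℓpos : 0 < ℓ := hδ₀.trans_le hℓ
  set s := (Finset.univ.erase i).filter (fun j => ℓ ≤ dist (y i) (y j)) with hs_def
  -- dyadic shell index `k = log₂ ⌊dist / ℓ⌋`
  set m : Fin N → ℕ := fun j => Nat.log 2 ⌊dist (y i) (y j) / ℓ⌋₊ with hm
  set t := s.image m with ht_def
  have hmem : ∀ j ∈ s, m j ∈ t := fun j hj => Finset.mem_image_of_mem m hj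
  have hjs : ∀ j ∈ s, ℓ ≤ dist (y i) (y j) := fun j hj => (Finset.mem_filter.1 hj).2
  have hfl1 : ∀ j ∈ s, 1 ≤ ⌊dist (y i) (y j) / ℓ⌋₊ := fun j hj =>
    (Nat.one_le_floor_iff _).2 ((one_le_div hℓpos).2 (hjs j hj))
  -- `2ᵏ ℓ ≤ dist`
  have hmle : ∀ j ∈ s, (2 : ℝ) ^ (m j) * ℓ ≤ dist (y i) (y j) := fun j hj => by
    have h1 : ((2 : ℕ) ^ (m j) : ℕ) ≤ ⌊dist (y i) (y j) / ℓ⌋₊ :=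
      Nat.pow_log_le_self 2 (Nat.one_le_iff_ne_zero.1 (hfl1 j hj))
    have h1' : (2 : ℝ) ^ (m j) ≤ (⌊dist (y i) (y j) / ℓ⌋₊ : ℝ) := by exact_mod_cast h1
    have h2 : (⌊dist (y i) (y j) / ℓ⌋₊ : ℝ) ≤ dist (y i) (y j) / ℓ :=
      Nat.floor_le (div_nonneg dist_nonneg hℓpos.le)
    have := h1'.trans h2
    rwa [le_div_iff₀ hℓpos] at this
  -- `dist < 2ᵏ⁺¹ ℓ`
  have hmlt : ∀ j ∈ s, dist (y i) (y j) < (2 : ℝ) ^ (m j + 1) * ℓ := fun j hj => by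
    have h1 : ⌊dist (y i) (y j) / ℓ⌋₊ < 2 ^ (m j + 1) := Nat.lt_pow_succ_log_self one_lt_two _
    have h2 : dist (y i) (y j) / ℓ < (⌊dist (y i) (y j) / ℓ⌋₊ : ℝ) + 1 := Nat.lt_floor_add_one _
    have h3 : (⌊dist (y i) (y j) / ℓ⌋₊ : ℝ) + 1 ≤ (2 : ℝ) ^ (m j + 1) := by exact_mod_cast h1
    have := h2.trans_le h3
    rwa [div_lt_iff₀ hℓpos] at this
  -- termwise: `dist⁻⁶ ≤ (2ᵏ ℓ)⁻⁶`
  have step1 : ∑ j ∈ s, (dist (y i) (y j))⁻¹ ^ 6 ≤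
      ∑ j ∈ s, ℓ⁻¹ ^ 6 * ((2 : ℝ) ^ (m j))⁻¹ ^ 6 := by
    refine Finset.sum_le_sum fun j hj => ?_
    rw [← mul_pow, ← mul_inv]
    have h0 : 0 < ℓ * 2 ^ (m j) := by positivity
    refine pow_le_pow_left₀ (inv_nonneg.2 dist_nonneg) (inv_anti₀ h0 ?_) _
    rw [mul_comm]
    exact hmle j hj
  -- regroup by shells
  have step2 : ∑ j ∈ s, ℓ⁻¹ ^ 6 * ((2 : ℝ) ^ (m j))⁻¹ ^ 6 =
      ∑ b ∈ t, ((s.filter fun j => m j = b).card : ℝ) * (ℓ⁻¹ ^ 6 * ((2 : ℝ) ^ b)⁻¹ ^ 6) := by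
    have := Finset.sum_fiberwise_of_maps_to' hmem (fun b : ℕ => ℓ⁻¹ ^ 6 * ((2 : ℝ) ^ b)⁻¹ ^ 6)
    simp only [Finset.sum_const, nsmul_eq_mul] at this
    exact this.symm
  -- each shell holds at most `(2 · 2ᵏ⁺¹ ℓ / δ₀ + 1)³` points (packing)
  have step3 : ∀ b ∈ t, ((s.filter fun j => m j = b).card : ℝ) ≤
      (2 * ((2 : ℝ) ^ (b + 1) * ℓ) / δ₀ + 1) ^ 3 := by
    intro b hb
    set F := s.filter fun j => m j = b with hF
    have hinj : Set.InjOn y F := fun k _ l _ hkl => by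
      by_contra hne
      have := hsep k l hne
      rw [hkl, dist_self] at this
      exact absurd this (not_le.2 hδ₀)
    rw [← Finset.card_image_of_injOn hinj]
    have hR : (0 : ℝ) ≤ (2 : ℝ) ^ (b + 1) * ℓ := by positivity
    have := card_le_of_separated_of_dist_le (F.image y) (y i) hδ₀ hR ?_ ?_
    · rwa [finrank_euclideanSpace_fin] at this
    · intro c hc
      obtain ⟨k, hk, rfl⟩ := Finset.mem_image.1 hc
      obtain ⟨hks', hkb⟩ := Finset.mem_filter.1 hk
      rw [dist_comm]
      have := hmlt k hks'
      rw [hkb] at this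
      exact this.le
    · intro c hc c' hc' hne
      obtain ⟨k, -, rfl⟩ := Finset.mem_image.1 hc
      obtain ⟨l, -, rfl⟩ := Finset.mem_image.1 hc'
      exact hsep k l fun h => hne (h ▸ rfl)
  -- numerics per shell
  have step4 : ∀ b : ℕ, (2 * ((2 : ℝ) ^ (b + 1) * ℓ) / δ₀ + 1) ^ 3 *
      (ℓ⁻¹ ^ 6 * ((2 : ℝ) ^ b)⁻¹ ^ 6) ≤ 125 * δ₀⁻¹ ^ 3 * ℓ⁻¹ ^ 3 * (1 / (2 : ℝ)) ^ b := by
    intro b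
    have hP : (1 : ℝ) ≤ 2 ^ b := one_le_pow₀ (by norm_num)
    have e1 : (2 : ℝ) ^ (b + 1) = 2 * 2 ^ b := by ring
    have e2 : (1 / (2 : ℝ)) ^ b = (2 ^ b)⁻¹ := by rw [one_div, inv_pow]
    rw [e1, e2]
    exact shell_numerics hδ₀ hℓ hP
  -- `∑ₖ 2⁻ᵏ ≤ 2`
  have step5 : ∑ b ∈ t, (1 / (2 : ℝ)) ^ b ≤ 2 := by
    have hsub : t ⊆ Finset.range (t.sup id + 1) := fun b hb =>
      Finset.mem_range.2 (Nat.lt_succ_of_le (Finset.le_sup (f := id) hb))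
    calc ∑ b ∈ t, (1 / (2 : ℝ)) ^ b ≤ ∑ b ∈ Finset.range (t.sup id + 1), (1 / (2 : ℝ)) ^ b :=
          Finset.sum_le_sum_of_subset_of_nonneg hsub fun b _ _ => by positivity
      _ ≤ 2 := sum_geometric_two_le _
  calc ∑ j ∈ s, (dist (y i) (y j))⁻¹ ^ 6
      ≤ ∑ b ∈ t, ((s.filter fun j => m j = b).card : ℝ) * (ℓ⁻¹ ^ 6 * ((2 : ℝ) ^ b)⁻¹ ^ 6) :=
        step1.trans_eq step2
    _ ≤ ∑ b ∈ t, (2 * ((2 : ℝ) ^ (b + 1) * ℓ) / δ₀ + 1) ^ 3 *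
          (ℓ⁻¹ ^ 6 * ((2 : ℝ) ^ b)⁻¹ ^ 6) :=
        Finset.sum_le_sum fun b hb => mul_le_mul_of_nonneg_right (step3 b hb) (by positivity)
    _ ≤ ∑ b ∈ t, 125 * δ₀⁻¹ ^ 3 * ℓ⁻¹ ^ 3 * (1 / (2 : ℝ)) ^ b :=
        Finset.sum_le_sum fun b _ => step4 b
    _ = 125 * δ₀⁻¹ ^ 3 * ℓ⁻¹ ^ 3 * ∑ b ∈ t, (1 / (2 : ℝ)) ^ b := by rw [Finset.mul_sum]
    _ ≤ 125 * δ₀⁻¹ ^ 3 * ℓ⁻¹ ^ 3 * 2 := mul_le_mul_of_nonneg_left step5 (by positivity)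
    _ = 250 * δ₀⁻¹ ^ 3 * ℓ⁻¹ ^ 3 := by ring

end Summit.AtomisticToContinuum.Crystallization.Theorems.PricedHcpWindowsFarTail
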